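import Summits.AtomisticToContinuum.Crystallization.Theorems.IsometryAtomsAtomicLawChargesCrystalFiniteOrbitsC
import Summits.AtomisticToContinuum.Crystallization.Theorems.IsometryAtomsAtomicLawChargesCrystalFiniteOrbitsD
import Literature.Geometry.DiscreteGeometry.MultiregularPointSystems

/-!
# Stub `stub_finiteOrbitsOfChargedClass` — a charged rooted isometry class has finitely many symmetry orbits

Line `Sketch` of the crux `IsometryAtoms.AtomicLawChargesCrystal` (stmt-AtomisticToContinuum-15778); the
route's Palm lever (idea `inverse-stabiliser-law`), lead prover's stub.

Let `P` be a point-stationary probability law on rooted configurations of `ℝ³`, a.s. rooted `δ`-hard-core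
(`δ > 0`), and let `D` be a Delone set whose rooted isometry classes `C_q = {count|A(D − q) : A}` are
measurable, whose atom event `⋃_{q ∈ D} C_q` is charged, and whose point stabilisers in
`Sym(D) = {g | g '' D = D}` have uniformly bounded order `≤ N`.  Then `Sym(D)` has finitely many orbits on
`D` (`Literature.Geometry.DiscreteGeometry.HasFinitelyManySymmetryOrbits`).

Proof.  (a) `D` is countable, so some class `C_a`, `a ∈ D`, is charged: `m := P(C_a) > 0`.
(b) For every `b ∈ D`, at the radius `r = dist b a` the detailed Mecke balance (helper C, `fo_balance`)
`P(C_a)·n_ab = P(C_b)·n_ba` and the inversion symmetry (helper D, `fo_orbitCount_mul_stab`)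
`n_ab·|Stab b| = n_ba·|Stab a|` — where `n_ab = #(Sym(D)·b ∩ B̄(a, r)) ≥ 1` — combine to
`P(C_a)·|Stab a| = P(C_b)·|Stab b|`, whence `P(C_a) ≤ N·P(C_b)` (the INVERSE-STABILISER LAW: class masses
are proportional to `1/|Stab|`).  (c) Class events of inequivalent roots are disjoint (helper A), so a
family of `k` pairwise inequivalent points of `D` has `k·m ≤ N·P(⋃ C) ≤ N`; if the orbits were infinite in
number such families would exist for every `k` — contradiction.
[cite: AldousLyons2007, Thm 3.1 ("unimodular fixed graphs": `p(x) ∝ 1/|Stab x|`); LyonsPeres2016, §8.2]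
-/

noncomputable section

namespace Summit.AtomisticToContinuum.Crystallization.Theorems.IsometryAtomsAtomicLawChargesCrystal

open MeasureTheory Metric Set
open scoped ENNReal

/-- **S3' — a charged rooted isometry class has finitely many symmetry orbits** (registered stub
`stub_finiteOrbitsOfChargedClass` of line `Sketch`; the inverse-stabiliser law from the detailed Mecke
balance and the inversion symmetry, see the module docstring).
[cite: AldousLyons2007, Thm 3.1; LyonsPeres2016, §8.2] -/
theorem stub_finiteOrbitsOfChargedClass : ∀ δ : ℝ, 0 < δ → ∀ P : MeasureTheory.Measure (MeasureTheory.Measure (EuclideanSpace ℝ (Fin 3))), MeasureTheory.IsProbabilityMeasure P → (∀ᵐ μ ∂P, Literature.Probability.Process.IsRootedHardCore δ μ) → Literature.Probability.Process.IsPointStationaryLaw P → ∀ D : Delone.DeloneSet (EuclideanSpace ℝ (Fin 3)), (∀ q : EuclideanSpace ℝ (Fin 3), MeasurableSet {μ : MeasureTheory.Measure (EuclideanSpace ℝ (Fin 3)) | ∃ A : EuclideanSpace ℝ (Fin 3) →ₗᵢ[ℝ] EuclideanSpace ℝ (Fin 3), μ = (MeasureTheory.Measure.count : MeasureTheory.Measure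 (EuclideanSpace ℝ (Fin 3))).restrict ((fun s => A (s - q)) '' (D : Set (EuclideanSpace ℝ (Fin 3))))}) → 0 < P {μ | ∃ A : EuclideanSpace ℝ (Fin 3) →ₗᵢ[ℝ] EuclideanSpace ℝ (Fin 3), ∃ q ∈ (D : Set (EuclideanSpace ℝ (Fin 3))), μ = (MeasureTheory.Measure.count : MeasureTheory.Measure (EuclideanSpace ℝ (Fin 3))).restrict ((fun s => A (s - q)) '' (D : Set (EuclideanSpace ℝ (Fin 3))))} → (∃ N : ℕ, ∀ x ∈ (D : Set (EuclideanSpace ℝ (Fin 3))), {g : EuclideanSpace ℝ (Fin 3) ≃ᵃⁱ[ℝ] EuclideanSpace ℝ (Fin 3) | g '' (D : Set (EuclideanSpace ℝ (Fin 3))) = (D : Set (EuclideanSpace ℝ (Fin 3))) ∧ g x = x}.encard ≤ N) → Literature.Geometry.DiscreteGeometry.HasFinitelyManySymmetryOrbits (D : Set (EuclideanSpace ℝ (Fin 3))) := by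
  intro δ hδ P hP hHC hSt D hmeas hpos hN
  classical
  obtain ⟨N, hN⟩ := hN
  set Dset : Set (EuclideanSpace ℝ (Fin 3)) := (D : Set (EuclideanSpace ℝ (Fin 3))) with hDset
  -- separation of `D`
  have hρ : 0 < (D.packingRadius : ℝ) := NNReal.coe_pos.2 D.packingRadius_pos
  have hsep : ∀ x ∈ Dset, ∀ y ∈ Dset, x ≠ y → (D.packingRadius : ℝ) ≤ dist x y :=
    fun x hx y hy hxy => (D.packingRadius_lt_dist_of_mem_ne hx hy hxy).le
  -- the class events
  set C : EuclideanSpace ℝ (Fin 3) → Set (Measure (EuclideanSpace ℝ (Fin 3))) := fun q =>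
    {μ | ∃ A : EuclideanSpace ℝ (Fin 3) →ₗᵢ[ℝ] EuclideanSpace ℝ (Fin 3),
      μ = (Measure.count : Measure (EuclideanSpace ℝ (Fin 3))).restrict ((fun s => A (s - q)) '' Dset)}
    with hC
  have hCmeas : ∀ q, MeasurableSet (C q) := fun q => hmeas q
  -- (a) a charged class
  have hDcount : Dset.Countable := fo_countable_of_separated hρ hsep
  have hUnion : {μ : Measure (EuclideanSpace ℝ (Fin 3)) | ∃ A : EuclideanSpace ℝ (Fin 3) →ₗᵢ[ℝ]
      EuclideanSpace ℝ (Fin 3), ∃ q ∈ Dset, μ = (Measure.count : Measure (EuclideanSpace ℝ (Fin 3))).restrict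
        ((fun s => A (s - q)) '' Dset)} = ⋃ q ∈ Dset, C q := by
    ext μ
    simp only [mem_setOf_eq, mem_iUnion, hC, exists_prop]
    constructor
    · rintro ⟨A, q, hq, h⟩
      exact ⟨q, hq, A, h⟩
    · rintro ⟨q, hq, A, h⟩
      exact ⟨A, q, hq, h⟩
  obtain ⟨a, ha, hma⟩ : ∃ a ∈ Dset, P (C a) ≠ 0 := by
    by_contra h
    push Not at h
    have h0 : P (⋃ q ∈ Dset, C q) = 0 := (measure_biUnion_null_iff hDcount).2 h
    rw [← hUnion] at h0
    exact hpos.ne' h0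
  -- (b) stabilisers: finite, of order between `1` and `N`
  have hstab_fin : ∀ x ∈ Dset, {σ : EuclideanSpace ℝ (Fin 3) ≃ᵃⁱ[ℝ] EuclideanSpace ℝ (Fin 3) |
      σ '' Dset = Dset ∧ σ x = x}.Finite := fun x hx => finite_of_encard_le_coe (hN x hx)
  have hstab_le : ∀ x ∈ Dset, {σ : EuclideanSpace ℝ (Fin 3) ≃ᵃⁱ[ℝ] EuclideanSpace ℝ (Fin 3) |
      σ '' Dset = Dset ∧ σ x = x}.ncard ≤ N := by
    intro x hx
    have h := hN x hx
    rw [← (hstab_fin x hx).cast_ncard_eq] at h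
    exact ENat.coe_le_coe.1 h
  have hone_sym : (1 : EuclideanSpace ℝ (Fin 3) ≃ᵃⁱ[ℝ] EuclideanSpace ℝ (Fin 3)) '' Dset = Dset := by
    rw [AffineIsometryEquiv.coe_one, Set.image_id]
  have hstab_pos : ∀ x ∈ Dset, 1 ≤ {σ : EuclideanSpace ℝ (Fin 3) ≃ᵃⁱ[ℝ] EuclideanSpace ℝ (Fin 3) |
      σ '' Dset = Dset ∧ σ x = x}.ncard := by
    intro x hx
    rw [Nat.one_le_iff_ne_zero, ← Nat.pos_iff_ne_zero, Set.ncard_pos (hstab_fin x hx)]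
    exact ⟨1, hone_sym, rfl⟩
  -- (c) orbit-ball sets are finite
  have horb_fin : ∀ x y : EuclideanSpace ℝ (Fin 3), ∀ R : ℝ,
      {s : EuclideanSpace ℝ (Fin 3) | s ∈ Dset ∧ (∃ g : EuclideanSpace ℝ (Fin 3) ≃ᵃⁱ[ℝ]
        EuclideanSpace ℝ (Fin 3), g '' Dset = Dset ∧ g x = s) ∧ dist s y ≤ R}.Finite := by
    intro x y R
    refine (Literature.Probability.Process.LocalConfig.finite_inter_of_separated hρ hsep
      (isCompact_closedBall y R)).subset ?_
    intro s hs
    exact ⟨mem_closedBall.2 hs.2.2, hs.1⟩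
  -- (d) the inverse-stabiliser law: `P(C_a) ≤ N · P(C_b)` for every `b ∈ D`
  have hkey : ∀ b ∈ Dset, P (C a) ≤ N * P (C b) := by
    intro b hb
    set r : ℝ := dist b a with hr
    -- the two orbit-ball counts and the two stabiliser orders
    set Tab : Set (EuclideanSpace ℝ (Fin 3)) := {s | s ∈ Dset ∧ (∃ g : EuclideanSpace ℝ (Fin 3) ≃ᵃⁱ[ℝ]
      EuclideanSpace ℝ (Fin 3), g '' Dset = Dset ∧ g b = s) ∧ dist s a ≤ r} with hTab
    set Tba : Set (EuclideanSpace ℝ (Fin 3)) := {s | s ∈ Dset ∧ (∃ g : EuclideanSpace ℝ (Fin 3) ≃ᵃⁱ[ℝ]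
      EuclideanSpace ℝ (Fin 3), g '' Dset = Dset ∧ g a = s) ∧ dist s b ≤ r} with hTba
    set Ka : ℕ := {σ : EuclideanSpace ℝ (Fin 3) ≃ᵃⁱ[ℝ] EuclideanSpace ℝ (Fin 3) |
      σ '' Dset = Dset ∧ σ a = a}.ncard with hKa
    set Kb : ℕ := {σ : EuclideanSpace ℝ (Fin 3) ≃ᵃⁱ[ℝ] EuclideanSpace ℝ (Fin 3) |
      σ '' Dset = Dset ∧ σ b = b}.ncard with hKb
    have hbal := fo_balance hρ hsep hSt hδ hHC hmeas a b r
    have hinv : Tab.ncard * Kb = Tba.ncard * Ka :=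
      fo_orbitCount_mul_stab a b ha hb r (hstab_fin a ha) (hstab_fin b hb) (horb_fin b a r) (horb_fin a b r)
    -- `b ∈ Tab`, so both counts are positive
    have hTab_pos : 1 ≤ Tab.ncard := by
      rw [Nat.one_le_iff_ne_zero, ← Nat.pos_iff_ne_zero, Set.ncard_pos (horb_fin b a r)]
      exact ⟨b, hb, ⟨1, hone_sym, rfl⟩, le_rfl⟩
    have hTba_pos : 1 ≤ Tba.ncard := by
      rw [Nat.one_le_iff_ne_zero]
      intro h0
      rw [h0, zero_mul] at hinv
      have := Nat.mul_pos (lt_of_lt_of_le Nat.zero_lt_one hTab_pos)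
        (lt_of_lt_of_le Nat.zero_lt_one (hstab_pos b hb))
      exact this.ne' hinv
    -- the balance in terms of `ncard`
    change P (C a) * Tab.encard = P (C b) * Tba.encard at hbal
    rw [← (horb_fin b a r).cast_ncard_eq, ← (horb_fin a b r).cast_ncard_eq] at hbal
    simp only [ENat.toENNReal_coe] at hbal
    -- multiply by `Kb` and use the inversion symmetry
    have h1 : P (C a) * ((Tba.ncard : ℝ≥0∞) * Ka) = P (C b) * ((Tba.ncard : ℝ≥0∞) * Kb) := by
      have hcast : (Tab.ncard : ℝ≥0∞) * Kb = (Tba.ncard : ℝ≥0∞) * Ka := by exact_mod_cast hinv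
      rw [← hcast, ← mul_assoc, hbal, mul_assoc]
    have h2 : P (C a) * Ka = P (C b) * Kb := by
      have hT0 : (Tba.ncard : ℝ≥0∞) ≠ 0 := by exact_mod_cast (Nat.one_le_iff_ne_zero.1 hTba_pos)
      have hTtop : (Tba.ncard : ℝ≥0∞) ≠ ⊤ := ENNReal.natCast_ne_top _
      apply (ENNReal.mul_right_inj hT0 hTtop).1
      calc (Tba.ncard : ℝ≥0∞) * (P (C a) * Ka) = P (C a) * ((Tba.ncard : ℝ≥0∞) * Ka) := by ring
        _ = P (C b) * ((Tba.ncard : ℝ≥0∞) * Kb) := h1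
        _ = (Tba.ncard : ℝ≥0∞) * (P (C b) * Kb) := by ring
    calc P (C a) ≤ P (C a) * Ka :=
          le_mul_of_one_le_right (by simp) (by exact_mod_cast hstab_pos a ha)
      _ = P (C b) * Kb := h2
      _ ≤ P (C b) * N := by gcongr; exact_mod_cast hstab_le b hb
      _ = N * P (C b) := mul_comm _ _
  -- (e) inequivalent families have bounded size, so the orbits are finite in number
  have hbound : ∀ F : Finset (EuclideanSpace ℝ (Fin 3)), (↑F : Set (EuclideanSpace ℝ (Fin 3))) ⊆ Dset →
      (∀ x ∈ F, ∀ y ∈ F, x ≠ y → ¬ ∃ g : EuclideanSpace ℝ (Fin 3) ≃ᵃⁱ[ℝ] EuclideanSpace ℝ (Fin 3),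
        g '' Dset = Dset ∧ g x = y) → (F.card : ℝ≥0∞) * P (C a) ≤ N := by
    intro F hFD hineq
    have hdisj : Set.PairwiseDisjoint (↑F : Set (EuclideanSpace ℝ (Fin 3))) C := by
      intro x hx y hy hxy
      rw [Function.onFun, Set.disjoint_left]
      intro μ hμx hμy
      exact hineq x hx y hy hxy (fo_sym_of_mem_classEvent_inter Dset x y μ hμx hμy)
    have hsum : P (⋃ x ∈ F, C x) = ∑ x ∈ F, P (C x) :=
      measure_biUnion_finset hdisj fun x _ => hCmeas x
    calc (F.card : ℝ≥0∞) * P (C a) = ∑ _x ∈ F, P (C a) := by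
          rw [Finset.sum_const, nsmul_eq_mul]
      _ ≤ ∑ x ∈ F, N * P (C x) := Finset.sum_le_sum fun x hx => hkey x (hFD hx)
      _ = N * ∑ x ∈ F, P (C x) := (Finset.mul_sum _ _ _).symm
      _ = N * P (⋃ x ∈ F, C x) := by rw [hsum]
      _ ≤ N * 1 := by gcongr; exact prob_le_one
      _ = N := mul_one _
  by_contra hnot
  have hfam : ∀ k : ℕ, ∃ F : Finset (EuclideanSpace ℝ (Fin 3)), (↑F : Set (EuclideanSpace ℝ (Fin 3))) ⊆ Dset ∧
      F.card = k ∧ ∀ x ∈ F, ∀ y ∈ F, x ≠ y → ¬ ∃ g : EuclideanSpace ℝ (Fin 3) ≃ᵃⁱ[ℝ]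
        EuclideanSpace ℝ (Fin 3), g '' Dset = Dset ∧ g x = y := by
    intro k
    induction k with
    | zero => exact ⟨∅, by simp, rfl, by simp⟩
    | succ k ih =>
      obtain ⟨F, hFD, hcard, hineq⟩ := ih
      -- a point of `D` whose orbit misses `F`
      have hnew : ∃ x ∈ Dset, ∀ g : EuclideanSpace ℝ (Fin 3) ≃ᵃⁱ[ℝ] EuclideanSpace ℝ (Fin 3),
          g '' Dset = Dset → g x ∉ (↑F : Set (EuclideanSpace ℝ (Fin 3))) := by
        by_contra h'
        push Not at h'
        exact hnot ⟨F, fun x hx => h' x hx⟩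
      obtain ⟨x, hx, hxF⟩ := hnew
      have hxnot : x ∉ F := by
        have := hxF 1 hone_sym
        simpa using this
      refine ⟨insert x F, ?_, by rw [Finset.card_insert_of_notMem hxnot, hcard], ?_⟩
      · intro y hy
        rw [Finset.coe_insert, Set.mem_insert_iff] at hy
        rcases hy with rfl | hy
        · exact hx
        · exact hFD hy
      · intro y hy z hz hyz
        rw [Finset.mem_insert] at hy hz
        rcases hy with rfl | hy <;> rcases hz with rfl | hz
        · exact absurd rfl hyz
        · rintro ⟨g, hg, hgy⟩
          exact hxF g hg (by rw [hgy]; exact hz)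
        · rintro ⟨g, hg, hgz⟩
          refine hxF g⁻¹ (g1a_image_inv hg) ?_
          rw [← hgz, AffineIsometryEquiv.coe_inv, AffineIsometryEquiv.symm_apply_apply]
          exact hy
        · exact hineq y hy z hz hyz
  obtain ⟨k, hk⟩ := ENNReal.exists_nat_mul_gt hma (ENNReal.natCast_ne_top N)
  obtain ⟨F, hFD, hcard, hineq⟩ := hfam k
  have hle := hbound F hFD hineq
  rw [hcard] at hle
  exact absurd (lt_of_lt_of_le hk hle) (lt_irrefl _)

end Summit.AtomisticToContinuum.Crystallization.Theorems.IsometryAtomsAtomicLawChargesCrystal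

end
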